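import Literature.MathematicalPhysics.QuantumLattice.DWaveSourceWindowCertificateD4
import Summits.HubbardSuperconductivity.HubbardLadder.PairSourceEnergyRowsBridge
import HarnessLib

/-!
# Hubbard ladder — route #2 (sourced energy response): the SOURCED WINDOW ROW TYPE and its kernel edge

HONEST FRAMING (cell pub-hubbard): ladder R1–R4 with certified numbers; no claim on `H`/`H₀`.
This file certifies NO number, contains NO claim node and runs nothing: no certificate of the kind
typed here exists, none is claimed, and no producer exists (engines REQUESTS L934/L978/L1006,
RULINGS R-259(b)); result line (iii) of the cell is unchanged ("no R3 instance has been run; no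
dichotomy is certified at any size; there are no brackets to overlap").

It is the pair-sourced analogue of `Bounds/WindowLowerRows.lean`'s `D4WindowCert`:

* `DWaveSourceWindowCert U μ h q` — the DATA of a reduce-mode SDP window certificate for the
  grand-canonical d-wave PAIR-SOURCED square-lattice Hubbard model
  `A_L = H_L(1,U) − μ N_L − h (Δ_L + Δ_Lᴴ)` (`dWaveSourceTorus L U μ h`), with certified constant
  `q = c − Σ_k ‖a_k‖` — exactly the hypotheses of the Literature soundness theorem
  `dWaveSourceTorus_groundEnergy_ge_of_window_certificate_d4_eventually` with every index family a
  finite type `Fin _`. Relative to `D4WindowCert`: the local objective carries the source terms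
  `−μ Σ_σ n_{0σ} − h(Δ₀ + Δ₀ᴴ)` and no density multipliers (grand-canonical), the point-group rows are
  restricted to the `D₂`-axis subgroup `χ_{B₁g}(γ) = 1` (field `hγ`; `C₄` and the diagonal reflections
  flip the sign of `h`), and the null ladder words must carry NONZERO SPIN CHARGE (field `hcw`;
  particle number is broken by the source, `S^z` is not).
* the generic kernel edge `DWaveSourceWindowCert.groundEnergy_ge_eventually :
  DWaveSourceWindowCert U μ h q → ∃ L₀, ∀ L ≥ L₀, q·L² ≤ E₀(dWaveSourceTorus L U μ h)` — which is
  LITERALLY the hypothesis `hb` of `PairSourceEnergyRowsBridge.lean`;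
* the typed obligation (house style, PROVED) `PairSourceWindowCertCeilingU8Eighth`: the torus-family
  upper node `luctiUpper_16k_U8_N224kk_ti4ds` ∧ ONE sourced window certificate with constant `q` at
  `U = 8` ∧ slack `s := −369071688991/2³⁹ − (7/8)μ − q > 0` ⇒ along every admissible sequence of
  normalised `S^z = 0` sector ground states at `δ = 1/8`, `liminf_k σ_d²(k) ≤ s²/(2h²)`
  (`pairSourceWindowCertCeilingU8Eighth_holds` = the kernel edge + `pairSourceEnergyRowsEdgeU8Eighth_holds`).

So a delivered, verifier-passed certificate FILE becomes ONE claim node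
`@[conjecture] def sourcedWindowLower_<tag> : Prop := Nonempty (DWaveSourceWindowCert 8 μ h q)` (to be
written then, next to this file, with the file's sha256 in its docstring — none exists today) and the
cell's number is `pairSourceWindowCertCeilingU8Eighth_holds ha μ h q hh hs ⟨C⟩ N ψ hNψ`.
Informativeness (labels, not claims): new only if `s²/(2h²) < 128/π⁴`
(`limsup_dWaveOrderParamSq_le_kinematic`); at the tree's `h = 0` bracket width `0.269` for
`(U, t′, n̄) = (8, 0, 7/8)` a realistic sourced slack is `s ≈ 0.3–0.45`, i.e. a ceiling `≈ 0.36–0.81` at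
`h̃ = 1/4` (R3 seat `R4-SOURCEROWS-SPEC.md` §5).

Sources: X. Han, arXiv:2006.06002 (2020) §3 (translation-invariant SDP certificates, the format);
T. Koma, H. Tasaki, J. Stat. Phys. 76 (1994) 745, Thm 2.2 (energy response vs order parameter);
D. J. Scalapino, Phys. Rep. 250 (1995) 329, §2 (the `d_{x²−y²}` form factor and its `B₁g` character).
-/

noncomputable section

namespace Summit.HubbardSuperconductivity.HubbardLadder.Bounds

open Matrix Filter Finset Literature.Probability.LatticeModels
open Literature.MathematicalPhysics.QuantumLattice
open Literature.MathematicalPhysics.QuantumManyBody.StateRelaxation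
open Summit.HubbardSuperconductivity.HubbardLadder
open scoped ComplexOrder BigOperators Topology

/-- `DWaveSourceWindowCert U μ h q`: the DATA of a reduce-mode (translations × `D₂`-axis point group,
`S^z`-charged null words) SDP window certificate for the pair-sourced grand-canonical square-lattice
Hubbard model `H(1,U) − μN − h(Δ_d + Δ_dᴴ)` with certified constant `q = c − Σ_k ‖a_k‖` — exactly the
hypotheses of `dWaveSourceTorus_groundEnergy_ge_of_window_certificate_d4_eventually` (Han 2020 §3
format with the pair-source objective) with every index family a finite type `Fin _`. No term of this
type is known or claimed. [cite: Han2020Bootstrap, §3] -/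
structure DWaveSourceWindowCert (U μ h q : ℝ) where
  /-- inner window `Λ` and outer window `Λ'` (the latter contains the closed star of `0` and the
  pair region of `0`, so that the sourced local objective lives in `𝔄_{Λ'}`) -/
  Λ : Finset (Site 2)
  Λ' : Finset (Site 2)
  hΛ : Λ ⊆ Λ'
  hclosed : ∀ x ∈ Λ, ∀ i : Fin 2, x + unitVec i ∈ Λ' ∧ x - unitVec i ∈ Λ'
  h0 : thicken ({0} : Finset (Site 2)) 1 ⊆ Λ'
  hz : (0 : Site 2) ∈ Λ'
  hP : pairRegion (insert (0 : Site 2) unitSteps) 0 ⊆ Λ'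
  /-- the SOS / Gram part -/
  m : ℕ
  Λm : Matrix (Fin m) (Fin m) ℂ
  hΛm : Λm.PosSemidef
  O : Fin m → FermionOp Λ'
  /-- equation-of-motion multipliers `[A_{Λ'}, B_k]` for the SOURCED window Hamiltonian -/
  k₁ : ℕ
  B : Fin k₁ → FermionOp Λ
  /-- translation-and-`D₂`-axis identification terms `γ·Y − Y` (`χ_{B₁g}(γ) = 1` only) -/
  k₂ : ℕ
  γ : Fin k₂ → DihedralGroup 4
  wv : Fin k₂ → Site 2
  hγ : ∀ l, b1gChar (γ l) = 1
  hsh : ∀ l, d4ShiftSet (γ l) (wv l) Λ ⊆ Λ'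
  Y : Fin k₂ → FermionOp Λ
  /-- SPIN-charged ladder words (particle number is NOT conserved by the sourced model) -/
  k₃ : ℕ
  b : Fin k₃ → ℂ
  cw : Fin k₃ → List (Orb (PolySite Λ') × Bool)
  hcw : ∀ j, ladderSpinCharge (cw j) ≠ 0
  /-- anti-Hermitian parts -/
  k₄ : ℕ
  dc : Fin k₄ → ℝ
  V : Fin k₄ → FermionOp Λ'
  /-- residual words with their coefficients (`Σ ‖a_k‖`) and the constant `c` -/
  k₅ : ℕ
  a : Fin k₅ → ℂ
  word : Fin k₅ → List (Orb (PolySite Λ') × Bool)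
  c : ℝ
  /-- the certificate identity in the CAR algebra of the window -/
  hcert : fermionEmbed (PolySite.incl h0) ((hubbardFermionInteraction 2 1 U).meanEnergyObs 1) -
          (μ : ℂ) • ∑ σ : Fin 2, nAt 0 hz σ -
          (h : ℂ) • (fermionEmbed (PolySite.incl hP) (localPairAt (insert (0 : Site 2) unitSteps) dWaveFormFactor 0) +
            (fermionEmbed (PolySite.incl hP) (localPairAt (insert (0 : Site 2) unitSteps) dWaveFormFactor 0))ᴴ) -
        (c : ℂ) • (1 : FermionOp Λ') =
      gramForm Λm O +
        (∑ k ∈ univ, (pairSourceWindowHamiltonian dWaveFormFactor Λ' U μ h * fermionEmbed (PolySite.incl hΛ) (B k) -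
            fermionEmbed (PolySite.incl hΛ) (B k) * pairSourceWindowHamiltonian dWaveFormFactor Λ' U μ h) +
          ∑ l ∈ univ, (fermionEmbed (PolySite.incl (hsh l)) (fermionEmbed (PolySite.d4Emb (γ l) (wv l) Λ) (Y l)) -
            fermionEmbed (PolySite.incl hΛ) (Y l)) +
          ∑ j ∈ univ, b j • ladderWord (cw j)) +
        (∑ m' ∈ univ, ((dc m' : ℝ) : ℂ) • ((V m')ᴴ - V m') + ∑ k ∈ univ, a k • ladderWord (word k))
  /-- the certified constant -/
  hq : c - ∑ k ∈ univ, ‖a k‖ = q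

/-- Generic kernel edge: ONE sourced window certificate with constant `q` bounds the ground-state
energy of EVERY large pair-sourced torus from below, `q·L² ≤ E₀(dWaveSourceTorus L U μ h)` for
`L ≥ L₀` — the hypothesis `hb` of `PairSourceEnergyRowsBridge.lean`, verbatim. Proof = the Literature
theorem `dWaveSourceTorus_groundEnergy_ge_of_window_certificate_d4_eventually` (all index Finsets `univ`).
[cite: Han2020Bootstrap, §3] -/
theorem DWaveSourceWindowCert.groundEnergy_ge_eventually {U μ h q : ℝ} (C : DWaveSourceWindowCert U μ h q) :
    ∃ L₀ : ℕ, ∀ (L : ℕ) [NeZero L], L₀ ≤ L → q * (L : ℝ) ^ 2 ≤ (dWaveSourceTorus L U μ h).groundEnergy := by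
  obtain ⟨L₀, hL₀⟩ := dWaveSourceTorus_groundEnergy_ge_of_window_certificate_d4_eventually U μ h C.hΛ
    C.hclosed C.h0 C.hz C.hP C.hΛm C.O univ C.B univ C.γ C.wv (fun l _ => C.hγ l) C.hsh C.Y univ C.b
    C.cw (fun j _ => C.hcw j) univ C.dc C.V univ C.a C.word C.hcert
  exact ⟨L₀, fun L _ hL => C.hq ▸ hL₀ L hL⟩

/-! ### Typed obligation (the cell's house style: `@[conjecture] def` + `_holds`) -/

/-- **Typed EDGE of route #2 from a certificate FILE (PROVED below; an implication, not a claim that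
any certificate exists)**: the torus-family upper node `luctiUpper_16k_U8_N224kk_ti4ds` AND one sourced
window certificate `DWaveSourceWindowCert 8 μ h q` with positive slack
`s = −369071688991/2³⁹ − (7/8)μ − q` imply, along every admissible sequence of normalised `S^z = 0`
sector ground states at `U = 8`, `δ = 1/8`, `liminf_k σ_d²(k) ≤ s²/(2h²)`. New as a statement only
when `s²/(2h²) < 128/π⁴` (`limsup_dWaveOrderParamSq_le_kinematic`).
HONEST FRAMING: ladder R1–R4 with certified numbers; no claim on `H`/`H₀`; nothing instantiated.
[cite: KomaTasaki1994, Theorem 2.2] [cite: Han2020Bootstrap, §3] -/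
@[conjecture] def PairSourceWindowCertCeilingU8Eighth : Prop :=
  luctiUpper_16k_U8_N224kk_ti4ds →
    ∀ (μ h q : ℝ), 0 < h → 0 < (-369071688991 : ℝ) / 2 ^ 39 - μ * (7 / 8) - q →
      Nonempty (DWaveSourceWindowCert 8 μ h q) →
        ∀ (N : ℕ → ℕ) (ψ : ∀ L, Fock (Orb (FermionTorus 2 L))),
          (∀ L, Even L → N L = 2 * ⌊(1 - 1 / 8) * (L : ℝ) ^ 2 / 2⌋₊ ∧ star (ψ L) ⬝ᵥ ψ L = 1 ∧
              IsGroundStateInSector (hubbardTorus 2 L 1 8) (N L) 0 (ψ L)) →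
            liminf (fun k => dWaveOrderParamSq ψ k) atTop ≤
              ((-369071688991 : ℝ) / 2 ^ 39 - μ * (7 / 8) - q) ^ 2 / (2 * h ^ 2)

/-- **Proof of `PairSourceWindowCertCeilingU8Eighth`** (the kernel edge
`DWaveSourceWindowCert.groundEnergy_ge_eventually` fed to `pairSourceEnergyRowsEdgeU8Eighth_holds`). -/
theorem pairSourceWindowCertCeilingU8Eighth_holds : PairSourceWindowCertCeilingU8Eighth := by
  intro ha μ h q hh hs hC N ψ hNψ
  obtain ⟨C⟩ := hC
  exact pairSourceEnergyRowsEdgeU8Eighth_holds ha μ h q hh hs C.groundEnergy_ge_eventually N ψ hNψ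

end Summit.HubbardSuperconductivity.HubbardLadder.Bounds
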